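/-
Copyright (c) 2026 the pub-hodgecm-mathlib formalisation cell (harness21).  Prover seat hodgecm-mathlib-K2E1-p09 (g6), Track B ∕ K2-LIT, h413 =
`stmt-HodgeConjecture-24833`, ENGINE E1, campaign «EIS-R7-BL-SPH-3» (the `N = 3` clone), queue item (i) of the dealer K2E1-plan (g5) 2026-09-04T09:38:27Z
(«P6′₃ §2 `K2E1BLUniquenessSelfAdjointU3` the minute K2E1-p02 posts P6′ §2 heads», ★ p859055).
-/
import Summits.HodgeConjecture.HodgeConjecture.Theorems.K2E1BLUniquenessU3   -- ★ p859028 (this seat, ED. 2): `uniqueSetSA_nonempty_three_of_lt`; transitively ★ p859055 (K2E1-p02 g6) P6′ ED. 2: `hunq_of_memLp_of_lt`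
import HarnessLib

/-!
# K2·E1 — `K2E1BLUniquenessSelfAdjointU3` (P6′₃, «EIS-R7-BL-SPH-3»): P8 PROPER'S LETTER `hunq` AT `N = 3` (`σ₀ = 2`) FROM ONE SYMMETRIC REAL TEST FUNCTION AND THE
# `L²`-LETTER

Track B ∕ K2-LIT, crux h413 = `stmt-HodgeConjecture-24833`, route of record `HCCMUnconditional`; cell `hodgecm-mathlib`, squad K2, ENGINE E1 (campaign «EIS-R7-BL», the BL-SPH-3
clone).  Prover seat `hodgecm-mathlib-K2E1-p09` (g6).  THEOREMS ONLY (no `def`, no `instance`, no notation, no named-fact hypothesis, no `sorry`; default heartbeats); lane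
`--supports stmt-HodgeConjecture-24833 --as helper` (count-neutral).  Closes no socket.

THE MATHEMATICS [BernsteinLapid2019, Thm 2.3 and §4 Claim 2 (p. 9); MoeglinWaldspurger1995, IV.1.9].  ★ P6′ (K2E1-p02 (g6), `K2E1BLUniquenessSelfAdjointU2` ED. 2) proves the
RANK-GENERIC, THRESHOLD-PARAMETRIC head `hunq_of_memLp_of_lt (σ₀) (n) …`: given Hecke operators `T i` on `𝓗_k(𝔛)` with `T i₀ = R(h_{i₀})` a.e. for ONE symmetric real `h_{i₀}`, the
packaged system's letters `ι P α₁ α₂ Q φ₀`, a GIVEN solution `(eX, bX)` on `ball 0 (n+2) ∩ {σ₀ < Re}`, the `L²`-letter `hL2` (homogeneous solutions at points of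
`U₀ = ball ∩ {σ₀ < Re} ∩ {Im ĥ_{i₀} ≠ 0}` are square-integrable) and the NON-EMPTINESS of `U₀` (letter `hne`), every solution at `z ∈ U₀` equals `eX z` (self-adjointness of `R(h_{i₀})`
kills the non-real eigenvalue `ĥ_{i₀}(z)`).  At `N = 2` the letter `hne` is discharged with `σ₀ = 1` (★ `hunq_of_memLp_two`).  THIS FILE is the `N = 3` instance: `σ₀ = 2` (the
abscissa of convergence of the `U(2,1)` Borel Eisenstein series is `Re z > 2`) and `hne` discharged by ★ `uniqueSetSA_nonempty_three_of_lt` (this seat, p859028: the torus ray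
`diag(z_E(e^s), 1, z_E(e^{−s}))` gives `1 ∈ closure {H > 1}` with NO `c² = 1`), which needs the window `ball 0 (n+2) ∩ {2 < Re}` to be non-empty, i.e. `0 < n`.

* §1 **`hunq_of_memLp_three (μ νG k n) (hn : 0 < n) (i₀ hhc hhs hsymm hreal h0 hh1 T hT ι P α₁ α₂ Q φ₀ eX bX hsolT hsolC hsolQ hL2)`** — ★ P8 §2's `hunq` at `N = 3`, `σ₀ = 2`,
  binders BYTE-FOR-BYTE those of ★ `hunq_of_memLp_two` with `2 ↦ 3`, `1 < z.re ↦ 2 < z.re`, `hc` dropped, `hn : 0 < n` added.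
HONEST LABEL: HC_CM is proved only modulo the 7 printed citations (2 remaining named inputs: hLiu418 = `stmt-HodgeConjecture-24832`, h413 = `stmt-HodgeConjecture-24833`) until rung 0
closes; this file asserts no named fact and closes no socket; count-neutral.

## References
* [BernsteinLapid2019] J. Bernstein, E. Lapid, *On the meromorphic continuation of Eisenstein series*, J. Amer. Math. Soc. 37 (2024) (arXiv:1911.02342): Thm 2.3, §4 Claim 2.
* [MoeglinWaldspurger1995] C. Mœglin, J.-L. Waldspurger, *Spectral decomposition and Eisenstein series*, CUP 1995: IV.1.9.
-/

set_option autoImplicit false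
set_option linter.dupNamespace false  -- the mandated namespace repeats the summit's segment (`HodgeConjecture.HodgeConjecture`)

noncomputable section

open MeasureTheory Measure Set NumberField Filter Topology Metric
open scoped NNReal ENNReal ComplexConjugate
open Literature.NumberTheory.Automorphic Literature.NumberTheory.Automorphic.UnitaryGroup AdelicGroupData
open Summit.HodgeConjecture.HodgeConjecture.Cruxes.H413.K2E1BLBorelSpacesU2Defs (HX supHeight)
open Summit.HodgeConjecture.HodgeConjecture.Cruxes.H413.K2E1BLUniquenessSelfAdjointU2 (hunq_of_memLp_of_lt)
open Summit.HodgeConjecture.HodgeConjecture.Cruxes.H413.K2E1BLUniquenessU3 (uniqueSetSA_nonempty_three_of_lt)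

namespace Summit.HodgeConjecture.HodgeConjecture.Cruxes.H413.K2E1BLUniquenessSelfAdjointU3

/-! ## §1 P6′ HEAD AT `N = 3` (`σ₀ = 2`) -/

/-- **P6′ HEAD AT `N = 3` — P8 PROPER'S LETTER `hunq` VERBATIM** (`σ₀ = 2`, `0 < n`): as ★ `hunq_of_memLp_of_lt` at `σ₀ = 2`, with the non-emptiness of
`U₀ = ball 0 (n+2) ∩ {2 < Re} ∩ {Im ĥ_{i₀} ≠ 0}` DISCHARGED by ★ `uniqueSetSA_nonempty_three_of_lt` from `Re h_{i₀} ≥ 0`, `h_{i₀}(1) ≠ 0` and `2 < n + 2` — automatic for the amended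
spec's `h = η^∨ ∗ η` (`h ≥ 0`, `h(1) = ‖η‖₂² > 0`).  The closer instantiates `ι := iota hb`, `P := cnstN k a μZ`, `α₁ α₂` the P8-β vectors (`H^z`, `H^{2−z}` at `N = 3`), `Q`, `(eX, bX)` =
«E_z solves the 𝔛-system» at `N = 3`, and is left with the single `L²`-letter `hL2`. [cite: BernsteinLapid2019, §4 Claim 2 (p. 9), Thm 2.3] [cite: MoeglinWaldspurger1995, IV.1.9] -/
theorem hunq_of_memLp_three {F E : Type} [Field F] [NumberField F] [Field E] [NumberField E] [Algebra F E] {c : E ≃ₐ[F] E}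
    [MeasurableSpace (quasiSplit F E c 3).Adelic] [BorelSpace (quasiSplit F E c 3).Adelic]
    (μ : Measure (quasiSplit F E c 3).automorphicQuotient) [(quasiSplit F E c 3).IsAutomorphicMeasure μ]
    (νG : Measure (quasiSplit F E c 3).Adelic) [νG.IsHaarMeasure] [νG.IsInvInvariant] (k n : ℕ) (hn : 0 < n) {I : Type*} (i₀ : I) {h : I → (quasiSplit F E c 3).Adelic → ℂ}
    (hhc : ∀ i, Continuous (h i)) (hhs : ∀ i, HasCompactSupport (h i)) (hsymm : ∀ g, h i₀ g⁻¹ = h i₀ g) (hreal : ∀ g, conj (h i₀ g) = h i₀ g)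
    (h0 : ∀ g, 0 ≤ (h i₀ g).re) (hh1 : h i₀ 1 ≠ 0)
    (T : I → HX F E c 3 k μ →L[ℂ] HX F E c 3 k μ)
    (hT : ∀ u : HX F E c 3 k μ, ((T i₀ u : HX F E c 3 k μ) : (quasiSplit F E c 3).automorphicQuotient → ℂ) =ᵐ[μ.withDensity fun x => (((supHeight F E c 3 x)⁻¹ ^ (2 * k) : ℝ≥0) : ℝ≥0∞)]
      fun ξ => ∫ y, h i₀ y * (u : (quasiSplit F E c 3).automorphicQuotient → ℂ) (y⁻¹ • ξ) ∂νG)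
    {V : Type*} [NormedAddCommGroup V] [NormedSpace ℂ V] (ι : HX F E c 3 k μ →L[ℂ] V) (P : V →L[ℂ] V) (α₁ α₂ : ℂ → V)
    {X' : Type*} [NormedAddCommGroup X'] [NormedSpace ℂ X'] (Q : HX F E c 3 k μ →L[ℂ] X') (φ₀ : ℂ) (eX : ℂ → HX F E c 3 k μ) (bX : ℂ → ℂ)
    (hsolT : ∀ z ∈ ball (0 : ℂ) (n + 2), 2 < z.re → ∀ i, T i (eX z) = (∫ x, h i x * (((borelHeight x : ℝ≥0) : ℝ) : ℂ) ^ z ∂νG) • eX z)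
    (hsolC : ∀ z ∈ ball (0 : ℂ) (n + 2), 2 < z.re → P (ι (eX z)) = φ₀ • α₁ z + bX z • α₂ z)
    (hsolQ : ∀ z ∈ ball (0 : ℂ) (n + 2), 2 < z.re → Q (eX z) = 0)
    (hL2 : ∀ z ∈ ball (0 : ℂ) (n + 2), 2 < z.re → (∫ x, h i₀ x * (((borelHeight x : ℝ≥0) : ℝ) : ℂ) ^ z ∂νG).im ≠ 0 →
      ∀ (ψ : HX F E c 3 k μ) (b' : ℂ), (∀ i, T i ψ = (∫ x, h i x * (((borelHeight x : ℝ≥0) : ℝ) : ℂ) ^ z ∂νG) • ψ) → P (ι ψ) = b' • α₂ z → Q ψ = 0 →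
        MemLp (ψ : (quasiSplit F E c 3).automorphicQuotient → ℂ) 2 μ) :
    ∃ U₀ : Set ℂ, IsOpen U₀ ∧ U₀.Nonempty ∧ U₀ ⊆ ball (0 : ℂ) (n + 2) ∩ {z : ℂ | 2 < z.re} ∧
      ∀ z ∈ U₀, ∀ (ψ : HX F E c 3 k μ) (b : ℂ), (∀ i, T i ψ = (∫ x, h i x * (((borelHeight x : ℝ≥0) : ℝ) : ℂ) ^ z ∂νG) • ψ) →
        P (ι ψ) = φ₀ • α₁ z + b • α₂ z → Q ψ = 0 → ψ = eX z := by
  have hre : ∀ g, (((h i₀ g).re : ℝ) : ℂ) = h i₀ g := fun g => Complex.conj_eq_iff_re.1 (hreal g)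
  refine hunq_of_memLp_of_lt μ νG k 2 n i₀ hhc hhs hsymm hreal ?_ T hT ι P α₁ α₂ Q φ₀ eX bX hsolT hsolC hsolQ hL2
  have hn' : (2 : ℝ) < n + 2 := by
    have : (0 : ℝ) < n := Nat.cast_pos.2 hn
    linarith
  have hne := uniqueSetSA_nonempty_three_of_lt νG (h := fun g => (h i₀ g).re) (Complex.continuous_re.comp (hhc i₀)) ((hhs i₀).comp_left Complex.zero_re) h0
    (fun h01 => hh1 (by rw [← hre 1, h01, Complex.ofReal_zero])) 2 n hn'
  have hfun : h i₀ = fun g => (((h i₀ g).re : ℝ) : ℂ) := funext fun g => (hre g).symm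
  rw [hfun]
  exact hne

end Summit.HodgeConjecture.HodgeConjecture.Cruxes.H413.K2E1BLUniquenessSelfAdjointU3

end
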